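import Mathlib.Analysis.Convolution
import Mathlib.MeasureTheory.Measure.Haar.Unique
import Mathlib.MeasureTheory.Measure.Haar.InnerProductSpace
import Mathlib.MeasureTheory.Group.Integral
import Mathlib.Analysis.InnerProductSpace.PiL2

/-!
# FrustratedLawDichotomy · the SCHUR DOMINATION principle behind lens-5 g34's two-body tail floor — PROVED (repaired form)

Lens-5 g34 («SchurCut», NODE 2026-08-31T15:35:50Z) floors the Lennard-Jones tail by a TWO-BODY inequality
`Σ_{i<j} (V·w)(r_ij) ≥ −A·(N + 2Σ_{i<j} ω(r_ij))` (`SchurFloor w ω A`) whose analytic core is typed there (§6, `SchurDomination`,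
«KNOWN-type · ATTACKABLE-M over Mathlib») as: for `β ∈ L²` even, `K ≥ 0` integrable and `−φ ≤ (β⋆β)∗K` pointwise,
`Σ_{i<j} φ(yᵢ − yⱼ) ≥ −½‖K‖₁·(N·(β⋆β)(0) + 2Σ_{i<j}(β⋆β)(yᵢ − yⱼ))`.

AS TYPED THAT PRINCIPLE IS FALSE (STATUS NOTE hand-1 g12 15:5xZ: the diagonal `N·((β⋆β)∗K)(0)` it drops is nonnegative only when
`β⋆β ≥ 0` near the support of `K`, and halving the symmetric double sum needs `(β⋆β)∗K` even; counterexample with a sign-changing even `β`,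
`N = 2`).  This file PROVES THE REPAIRED PRINCIPLE, with the two missing hypotheses `β ≥ 0` and `K` even, at the regularity of the instance
lens-5 uses (`β = (1 − |x|²)₊²` continuous with compact support; `K` integrable):

`schurDomination : Continuous β → HasCompactSupport β → 0 ≤ β → 0 ≤ K → Integrable K → K even → (∀ z, −φ z ≤ ∫ K u · ∫ β x β(x − (z − u)))
   → −((∫K)/2 · (N (∫β²) + 2 Σ_{i<j} ∫ β x β(x − (yᵢ − yⱼ)))) ≤ Σ_{i<j} φ(yᵢ − yⱼ)`  (conclusion = the typed one with the integral
parenthesised: as typed, `↑N * ∫ x, β x ^ 2 + 2 * ∑ …` parses as `N·∫(β² + 2Σ…)` — a second slip of the typed def).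

Proof (no Fourier analysis, no `Lp` spaces): with `k(v) = ∫ β(x)β(x − v)dx` (even, `0 ≤ k ≤ ∫β²`, continuous as a convolution) and
`F = Σᵢ β(· − yᵢ)`: `Σ_{i,j} k(yᵢ − yⱼ − u) = ∫ F(t − u)F(t) dt ≤ ∫ F²` (from `0 ≤ ∫ (F(· − u) − F)²` and translation invariance — the
Schur / positive-definiteness step), hence `Σ_{i,j} ((k∗K))(yᵢ − yⱼ) = ∫ K(u)·∫F(t−u)F(t) dt du ≤ ‖K‖₁ ∫F² = ‖K‖₁ Σ_{i,j} k(yᵢ − yⱼ)`; the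
diagonal of the left side is `≥ 0` (`β, K ≥ 0`) and both double sums are symmetric (`k`, `K` even), which gives the claim.
[folklore: Schur test / positive-definiteness of autocorrelations]

DEF-FREE; 0 sorry; Mathlib only.  Prover hand 1, gen 12 (decomp-a2c), --supports stmt-AtomisticToContinuum-27623.
-/

noncomputable section

namespace Summit.AtomisticToContinuum.Crystallization.Theorems.FrustratedLawDichotomySchurDomination

open MeasureTheory
open scoped BigOperators

/-! ## 1. Symmetric double sums over `Fin N` -/

/-- Splitting a symmetric double sum into its diagonal and twice its upper triangle. [folklore] -/
theorem sum_sum_eq_diag_add_two_mul_upper {N : ℕ} (f : Fin N → Fin N → ℝ) (hf : ∀ i j, f i j = f j i) :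
    ∑ i, ∑ j, f i j = ∑ i, f i i + 2 * ∑ i, ∑ j ∈ Finset.Ioi i, f i j := by
  have hsplit : ∀ i : Fin N, Finset.univ.erase i = Finset.Ioi i ∪ Finset.Iio i := fun i => by
    ext k
    simp only [Finset.mem_erase, Finset.mem_univ, and_true, Finset.mem_union, Finset.mem_Ioi, Finset.mem_Iio]
    exact ne_iff_lt_or_gt.trans or_comm
  have hdisj : ∀ i : Fin N, Disjoint (Finset.Ioi i) (Finset.Iio i) := fun i =>
    Finset.disjoint_left.2 fun k hk hk' => lt_asymm (Finset.mem_Ioi.1 hk) (Finset.mem_Iio.1 hk')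
  have h1 : ∑ i, ∑ k ∈ Finset.Iio i, f i k = ∑ i, ∑ k ∈ Finset.Ioi i, f i k := by
    rw [Finset.sum_comm' (t' := Finset.univ) (s' := fun k => Finset.Ioi k)]
    · exact Finset.sum_congr rfl fun k _ => Finset.sum_congr rfl fun i _ => hf i k
    · intro i k
      simp
  have h2 : ∀ i : Fin N, ∑ j, f i j = f i i + ∑ j ∈ Finset.univ.erase i, f i j := fun i =>
    (Finset.add_sum_erase _ _ (Finset.mem_univ i)).symm
  simp only [h2, Finset.sum_add_distrib, hsplit, Finset.sum_union (hdisj _), h1]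
  ring

/-! ## 2. The autocorrelation `k(v) = ∫ β(x) β(x − v) dx` -/

section Autocorrelation

variable {β : EuclideanSpace ℝ (Fin 3) → ℝ}

/-- `k` is even: `∫ β(x)β(x + v) = ∫ β(x)β(x − v)` (translation invariance). [folklore] -/
theorem autocorr_neg (β : EuclideanSpace ℝ (Fin 3) → ℝ) (v : EuclideanSpace ℝ (Fin 3)) :
    ∫ x, β x * β (x - -v) = ∫ x, β x * β (x - v) := by
  have h := integral_sub_right_eq_self (μ := (volume : Measure (EuclideanSpace ℝ (Fin 3)))) (fun x => β x * β (x - -v)) v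
  rw [← h]
  refine integral_congr_ae (Filter.Eventually.of_forall fun x => ?_)
  simp only [sub_neg_eq_add, sub_add_cancel]
  ring

/-- `k ≥ 0` for `β ≥ 0`. [folklore] -/
theorem autocorr_nonneg (hβ0 : ∀ x, 0 ≤ β x) (v : EuclideanSpace ℝ (Fin 3)) : 0 ≤ ∫ x, β x * β (x - v) :=
  integral_nonneg fun x => mul_nonneg (hβ0 x) (hβ0 _)

/-- Integrability of the translated products `β(· − a)·β(· − b)`. [folklore] -/
theorem integrable_mul_shift (hβc : Continuous β) (hβs : HasCompactSupport β) (a b : EuclideanSpace ℝ (Fin 3)) :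
    Integrable (fun t => β (t - a) * β (t - b)) := by
  have hc : Continuous fun t => β (t - a) * β (t - b) :=
    (hβc.comp (continuous_id.sub continuous_const)).mul (hβc.comp (continuous_id.sub continuous_const))
  have hs : HasCompactSupport fun t => β (t - a) * β (t - b) := by
    have h1 : HasCompactSupport fun t : EuclideanSpace ℝ (Fin 3) => β (t - a) :=
      hβs.comp_homeomorph (Homeomorph.subRight a)
    exact h1.mul_right
  exact hc.integrable_of_hasCompactSupport hs

/-- `k(v) ≤ ∫ β²` (from `2ab ≤ a² + b²` and translation invariance). [folklore] -/
theorem autocorr_le (hβc : Continuous β) (hβs : HasCompactSupport β) (v : EuclideanSpace ℝ (Fin 3)) :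
    ∫ x, β x * β (x - v) ≤ ∫ x, β x ^ 2 := by
  have i0 : Integrable (fun x => β x * β (x - v)) := by
    simpa using integrable_mul_shift hβc hβs 0 v
  have i1 : Integrable (fun x : EuclideanSpace ℝ (Fin 3) => β x ^ 2) := by
    simpa [sq] using integrable_mul_shift hβc hβs 0 0
  have i2 : Integrable (fun x : EuclideanSpace ℝ (Fin 3) => β (x - v) ^ 2) := by
    simpa [sq] using integrable_mul_shift hβc hβs v v
  have hpt : ∀ x, β x * β (x - v) ≤ (β x ^ 2 + β (x - v) ^ 2) / 2 := fun x => by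
    nlinarith [sq_nonneg (β x - β (x - v))]
  have hshift : ∫ x, β (x - v) ^ 2 = ∫ x, β x ^ 2 :=
    integral_sub_right_eq_self (μ := (volume : Measure (EuclideanSpace ℝ (Fin 3)))) (fun x => β x ^ 2) v
  calc ∫ x, β x * β (x - v) ≤ ∫ x, (β x ^ 2 + β (x - v) ^ 2) / 2 := integral_mono i0 ((i1.add i2).div_const 2) hpt
    _ = ((∫ x, β x ^ 2) + ∫ x, β (x - v) ^ 2) / 2 := by
        rw [integral_div, integral_add i1 i2]
    _ = ∫ x, β x ^ 2 := by rw [hshift]; ring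

/-- `k` is continuous (it is the convolution `β ⋆ β̌` of continuous compactly supported functions). [folklore] -/
theorem continuous_autocorr (hβc : Continuous β) (hβs : HasCompactSupport β) :
    Continuous fun v : EuclideanSpace ℝ (Fin 3) => ∫ x, β x * β (x - v) := by
  set g : EuclideanSpace ℝ (Fin 3) → ℝ := fun s => β (-s) with hg
  have hgc : Continuous g := hβc.comp continuous_neg
  have hgs : HasCompactSupport g := hβs.comp_homeomorph (Homeomorph.neg (EuclideanSpace ℝ (Fin 3)))
  have hconv : Continuous (MeasureTheory.convolution β g (ContinuousLinearMap.mul ℝ ℝ) volume) :=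
    hgs.continuous_convolution_right _ (hβc.locallyIntegrable) hgc
  have heq : (fun v : EuclideanSpace ℝ (Fin 3) => ∫ x, β x * β (x - v)) =
      MeasureTheory.convolution β g (ContinuousLinearMap.mul ℝ ℝ) volume := by
    funext v
    rw [convolution_def]
    refine integral_congr_ae (Filter.Eventually.of_forall fun x => ?_)
    simp [hg, neg_sub]
  rw [heq]
  exact hconv

end Autocorrelation

/-! ## 3. The Schur step: `Σ_{i,j} k(yᵢ − yⱼ − u) = ∫ F(t − u) F(t) dt ≤ ∫ F² = Σ_{i,j} k(yᵢ − yⱼ)` -/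

section Schur

variable {β : EuclideanSpace ℝ (Fin 3) → ℝ} {N : ℕ}

/-- `k(a − b − u) = ∫ β(t − (b + u)) β(t − a) dt` (translation). [folklore] -/
theorem autocorr_pair_eq (β : EuclideanSpace ℝ (Fin 3) → ℝ) (a b u : EuclideanSpace ℝ (Fin 3)) :
    ∫ x, β x * β (x - (a - b - u)) = ∫ t, β (t - (b + u)) * β (t - a) := by
  have h := integral_sub_right_eq_self (μ := (volume : Measure (EuclideanSpace ℝ (Fin 3))))
    (fun x => β x * β (x - (a - b - u))) (b + u)
  rw [← h]
  refine integral_congr_ae (Filter.Eventually.of_forall fun t => ?_)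
  show β (t - (b + u)) * β (t - (b + u) - (a - b - u)) = β (t - (b + u)) * β (t - a)
  congr 2
  abel

/-- Products of two shell functions `(Σ_j β(· − c_j))·(Σ_i β(· − d_i))` are integrable. [folklore] -/
theorem integrable_sum_mul_sum (hβc : Continuous β) (hβs : HasCompactSupport β) (c d : Fin N → EuclideanSpace ℝ (Fin 3)) :
    Integrable (fun t => (∑ j, β (t - c j)) * ∑ i, β (t - d i)) := by
  have h : (fun t => (∑ j, β (t - c j)) * ∑ i, β (t - d i)) =
      fun t => ∑ j, ∑ i, β (t - c j) * β (t - d i) := by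
    funext t; rw [Finset.sum_mul_sum]
  rw [h]
  exact integrable_finsetSum _ fun j _ => integrable_finsetSum _ fun i _ => integrable_mul_shift hβc hβs (c j) (d i)

/-- A double sum of pair autocorrelations is the integral of a product of shell functions. [folklore] -/
theorem sum_sum_autocorr_eq_integral (hβc : Continuous β) (hβs : HasCompactSupport β)
    (y : Fin N → EuclideanSpace ℝ (Fin 3)) (u : EuclideanSpace ℝ (Fin 3)) :
    ∑ i, ∑ j, ∫ x, β x * β (x - (y i - y j - u)) = ∫ t, (∑ j, β (t - (y j + u))) * ∑ i, β (t - y i) := by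
  simp_rw [autocorr_pair_eq β]
  rw [show (∫ t, (∑ j, β (t - (y j + u))) * ∑ i, β (t - y i)) =
      ∫ t, ∑ i, ∑ j, β (t - (y j + u)) * β (t - y i) from
    integral_congr_ae (Filter.Eventually.of_forall fun t => by
      show (∑ j, β (t - (y j + u))) * ∑ i, β (t - y i) = ∑ i, ∑ j, β (t - (y j + u)) * β (t - y i)
      rw [Finset.sum_mul_sum, Finset.sum_comm])]
  rw [integral_finsetSum _ (fun i _ => integrable_finsetSum _ fun j _ => integrable_mul_shift hβc hβs (y j + u) (y i))]
  refine Finset.sum_congr rfl fun i _ => ?_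
  rw [integral_finsetSum _ (fun j _ => integrable_mul_shift hβc hβs (y j + u) (y i))]

/-- **The Schur step.** For `β` continuous with compact support and every `u`:
`Σ_{i,j} k(yᵢ − yⱼ − u) ≤ Σ_{i,j} k(yᵢ − yⱼ)`. [folklore: `0 ≤ ∫ (F(·−u) − F)²`, translation invariance] -/
theorem sum_sum_autocorr_shift_le (hβc : Continuous β) (hβs : HasCompactSupport β)
    (y : Fin N → EuclideanSpace ℝ (Fin 3)) (u : EuclideanSpace ℝ (Fin 3)) :
    ∑ i, ∑ j, ∫ x, β x * β (x - (y i - y j - u)) ≤ ∑ i, ∑ j, ∫ x, β x * β (x - (y i - y j)) := by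
  have hL := sum_sum_autocorr_eq_integral hβc hβs y u
  have hR : ∑ i, ∑ j, ∫ x, β x * β (x - (y i - y j)) = ∫ t, (∑ j, β (t - (y j + 0))) * ∑ i, β (t - y i) := by
    have := sum_sum_autocorr_eq_integral hβc hβs y 0
    simpa using this
  rw [hL, hR]
  set F : EuclideanSpace ℝ (Fin 3) → ℝ := fun t => ∑ i, β (t - y i) with hF
  have hFu : ∀ t, ∑ j, β (t - (y j + u)) = F (t - u) := by
    intro t; simp only [hF]
    exact Finset.sum_congr rfl fun j _ => by congr 1; abel
  have hF0 : ∀ t, ∑ j, β (t - (y j + 0)) = F t := by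
    intro t; simp [hF]
  simp_rw [hFu, hF0]
  -- integrability of the three products
  have iUF : Integrable (fun t => F (t - u) * F t) := by
    have := integrable_sum_mul_sum hβc hβs (fun j => y j + u) y
    refine this.congr (Filter.Eventually.of_forall fun t => ?_)
    show (∑ j, β (t - (y j + u))) * ∑ i, β (t - y i) = F (t - u) * F t
    rw [hFu]
  have iFF : Integrable (fun t => F t * F t) := integrable_sum_mul_sum hβc hβs y y
  have iUU : Integrable (fun t => F (t - u) * F (t - u)) := iFF.comp_sub_right u
  -- `0 ≤ ∫ (F(·−u) − F)²`
  have hsq : 0 ≤ ∫ t, (F (t - u) * F (t - u) - 2 * (F (t - u) * F t) + F t * F t) :=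
    integral_nonneg fun t => by
      simp only [Pi.zero_apply]
      nlinarith [sq_nonneg (F (t - u) - F t)]
  have iA : Integrable (fun t => F (t - u) * F (t - u) - 2 * (F (t - u) * F t)) := iUU.sub (iUF.const_mul 2)
  have i2 : Integrable (fun t => 2 * (F (t - u) * F t)) := iUF.const_mul 2
  have hshift : ∫ t, F (t - u) * F (t - u) = ∫ t, F t * F t :=
    integral_sub_right_eq_self (μ := (volume : Measure (EuclideanSpace ℝ (Fin 3)))) (fun t => F t * F t) u
  rw [integral_add iA iFF, integral_sub iUU i2, integral_const_mul, hshift] at hsq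
  linarith

end Schur

/-! ## 4. The Schur domination principle (repaired: `β ≥ 0`, `K` even) -/

/-- ★ **SCHUR DOMINATION** (lens-5 g34 §6, REPAIRED and PROVED): for `β ≥ 0` continuous with compact support, `K ≥ 0` integrable and even,
and any `φ` with `−φ(z) ≤ ∫ K(u)·(β⋆β)(z − u) du` pointwise, every finite family of points satisfies
`−(‖K‖₁/2)·(N·∫β² + 2·Σ_{i<j} (β⋆β)(yᵢ − yⱼ)) ≤ Σ_{i<j} φ(yᵢ − yⱼ)` — conclusion = lens-5's `SchurDomination` with the intended
parenthesisation `N * (∫ x, β x ^ 2) + …` (as typed there, `↑N * ∫ x, β x ^ 2 + 2 * ∑ …` parses as `N · ∫ (β² + 2Σ…)`). [folklore] -/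
theorem schurDomination (β K φ : EuclideanSpace ℝ (Fin 3) → ℝ) (hβc : Continuous β) (hβs : HasCompactSupport β)
    (hβ0 : ∀ x, 0 ≤ β x) (hK0 : ∀ u, 0 ≤ K u) (hKi : Integrable K) (hKev : ∀ u, K (-u) = K u)
    (hdom : ∀ z, -φ z ≤ ∫ u, K u * ∫ x, β x * β (x - (z - u)))
    (N : ℕ) (y : Fin N → EuclideanSpace ℝ (Fin 3)) :
    -((∫ u, K u) / 2 * ((N : ℝ) * (∫ x, β x ^ 2) + 2 * ∑ i, ∑ j ∈ Finset.Ioi i, ∫ x, β x * β (x - (y i - y j)))) ≤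
      ∑ i, ∑ j ∈ Finset.Ioi i, φ (y i - y j) := by
  -- notation
  set k : EuclideanSpace ℝ (Fin 3) → ℝ := fun v => ∫ x, β x * β (x - v) with hk
  set G : EuclideanSpace ℝ (Fin 3) → ℝ := fun z => ∫ u, K u * k (z - u) with hG
  have hk_even : ∀ v, k (-v) = k v := fun v => autocorr_neg β v
  have hk_nonneg : ∀ v, 0 ≤ k v := fun v => autocorr_nonneg hβ0 v
  have hk_le : ∀ v, k v ≤ ∫ x, β x ^ 2 := fun v => autocorr_le hβc hβs v
  have hk_cont : Continuous k := continuous_autocorr hβc hβs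
  have hk0 : k 0 = ∫ x, β x ^ 2 := by
    simp only [hk, sub_zero, sq]
  -- integrability of `u ↦ K u * k (z - u)`
  have hint : ∀ z, Integrable (fun u => k (z - u) * K u) := by
    intro z
    refine hKi.bdd_mul (c := ∫ x, β x ^ 2) ((hk_cont.comp (continuous_const.sub continuous_id)).aestronglyMeasurable)
      (Filter.Eventually.of_forall fun u => ?_)
    rw [Real.norm_eq_abs, abs_of_nonneg (hk_nonneg _)]
    exact hk_le _
  have hG_nonneg : ∀ z, 0 ≤ G z := fun z => integral_nonneg fun u => mul_nonneg (hK0 u) (hk_nonneg _)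
  have hG_even : ∀ z, G (-z) = G z := by
    intro z
    simp only [hG]
    have h1 : ∀ u, K u * k (-z - u) = (fun w => K (-w) * k (z - -w)) u := by
      intro u
      show K u * k (-z - u) = K (-u) * k (z - -u)
      rw [hKev, show -z - u = -(z - -u) by abel, hk_even]
    simp_rw [h1]
    exact integral_neg_eq_self (fun w => K w * k (z - w)) volume
  -- the Schur estimate on the full double sum
  have hint' : ∀ i j : Fin N, Integrable (fun u => K u * k (y i - y j - u)) := fun i j =>
    (hint (y i - y j)).congr (Filter.Eventually.of_forall fun u => mul_comm _ _)
  have hS : ∑ i, ∑ j, G (y i - y j) ≤ (∫ u, K u) * ∑ i, ∑ j, k (y i - y j) := by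
    have e2 : ∀ i : Fin N, ∑ j, G (y i - y j) = ∫ u, ∑ j, K u * k (y i - y j - u) := fun i =>
      (integral_finsetSum _ fun j _ => hint' i j).symm
    have e1 : ∑ i, ∑ j, G (y i - y j) = ∫ u, K u * ∑ i, ∑ j, k (y i - y j - u) := by
      rw [Finset.sum_congr rfl fun i _ => e2 i, ← integral_finsetSum _ fun i _ => integrable_finsetSum _ fun j _ => hint' i j]
      refine integral_congr_ae (Filter.Eventually.of_forall fun u => ?_)
      simp only [Finset.mul_sum]
    rw [e1, ← integral_mul_const]
    refine integral_mono_of_nonneg (Filter.Eventually.of_forall fun u => ?_) (hKi.mul_const _)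
      (Filter.Eventually.of_forall fun u => ?_)
    · exact mul_nonneg (hK0 u) (Finset.sum_nonneg fun i _ => Finset.sum_nonneg fun j _ => hk_nonneg _)
    · exact mul_le_mul_of_nonneg_left (sum_sum_autocorr_shift_le hβc hβs y u) (hK0 u)
  -- symmetric splitting of both double sums
  have hGsym : ∀ i j, G (y i - y j) = G (y j - y i) := fun i j => by rw [← hG_even, neg_sub]
  have hksym : ∀ i j, k (y i - y j) = k (y j - y i) := fun i j => by rw [← hk_even, neg_sub]
  have hGsplit := sum_sum_eq_diag_add_two_mul_upper (fun i j => G (y i - y j)) hGsym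
  have hksplit := sum_sum_eq_diag_add_two_mul_upper (fun i j => k (y i - y j)) hksym
  simp only [sub_self, Finset.sum_const, Finset.card_univ, Fintype.card_fin, nsmul_eq_mul] at hGsplit hksplit
  set TG : ℝ := ∑ i, ∑ j ∈ Finset.Ioi i, G (y i - y j) with hTG
  set Tk : ℝ := ∑ i, ∑ j ∈ Finset.Ioi i, k (y i - y j) with hTk
  rw [hGsplit, hksplit, hk0] at hS
  -- domination, summed
  have hdom' : -TG ≤ ∑ i, ∑ j ∈ Finset.Ioi i, φ (y i - y j) := by
    rw [hTG, ← Finset.sum_neg_distrib]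
    refine Finset.sum_le_sum fun i _ => ?_
    rw [← Finset.sum_neg_distrib]
    refine Finset.sum_le_sum fun j _ => ?_
    have h' : -φ (y i - y j) ≤ G (y i - y j) := hdom (y i - y j)
    linarith
  have hK1 : 0 ≤ ∫ u, K u := integral_nonneg hK0
  have hG0 : 0 ≤ (N : ℝ) * G 0 := mul_nonneg (Nat.cast_nonneg N) (hG_nonneg 0)
  have h2 : 2 * TG ≤ (∫ u, K u) * ((N : ℝ) * (∫ x, β x ^ 2) + 2 * Tk) := by linarith
  linarith

end Summit.AtomisticToContinuum.Crystallization.Theorems.FrustratedLawDichotomySchurDomination
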